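import Summits.BirchSwinnertonDyer.BirchSwinnertonDyer.Theorems.ByReductionTypeAtTwoRankOneAtTwoOneDoorLawFirstLayerDefs
import Summits.BirchSwinnertonDyer.BirchSwinnertonDyer.Theorems.ByReductionTypeAtTwoRankOneAtTwoBigImageOddLocalOneDoorSubsliceNegDiscConverse
import Summits.BirchSwinnertonDyer.Rank1Residual.F1Sign2.CasselsTateSignAtTwo
import HarnessLib

/-!
# Cell `bsd-f1-sign2` — ES lens (-es g18, MEMO-es §27 + §27-add; D-es-61): ES-27 «THE SECOND LAYER AT A MINIMAL ARCHIMEDEAN DOOR»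
# (a typed θ-split of the lead's non-egg residue R_N `DoorIndexLawFullCAtTwoSomeDoorResidueNonEgg`: L₁ / U₁ / SUPPLY₄ + the import-free glue `L₁ ∧ SUPPLY₄ ⟹ R_N`)

STATEMENTS ONLY (+ -es's two import-free glue theorems and one REF1 glue theorem), typer -ty g17.  Port asked by -es g18 (MEMO-es §27.8 D-es-61: «port
`Sketch27.lean` as `Theorems/ByReductionTypeAtTwoRankOneAtTwoOneDoorLawSecondLayerDefs.lean`»), REF-GATED until REF1 g18 §193 (INBOX 2026-08-29T12:09:57Z:
«ES-27 port UN-GATED with ONE mandatory re-type»).  HOMING: `Summits/…/Theorems/` is prover-only and route-directed for the gate (D-0016: `perm.theorems-prover-only`,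
`perm.theorems-item` on the typer's preflight), so the cell typer files the statements HERE in the cell folder `F1Sign2/` under the cell namespace
`…Rank1Residual.F1Sign2.SecondLayerAtMinimalDoorAtTwo`, `open`ing -es's `…Theorems.RankOneAtTwoOneDoor` (decl bodies unchanged; the glue still targets the lead's
`DoorIndexLawFullCAtTwoSomeDoorResidueNonEgg`); a prover / LEAD who wants the D-es-61 path re-homes by `import` + `export`, nothing to re-type.  Source: `HOME/data-es/g18/lean/Sketch27.lean` **e8eadf05d26b66de** (159 l., rc 0, 0 sorry; -es's `Probe27.lean` /
`Probe27.txt` 3/3 crux probes CLEAN); REF1's probe `HOME/REF1-data/b193/lean/Probe193.lean` **629f12b20d507e93** (= Sketch27 l.5–156 VERBATIM + 3 probes + 9 BC7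
lemmas; FARM rc 0, exactly 3 sorries).  WHAT IS FILED: U₁ `HeegnerExponentLowerBoundAtShaDeepMinimalDoorNonEggAtTwo` and SUPPLY₄ `ShaFourMinimalDoorSupplyNonEggAtTwo`
VERBATIM (bodies byte-identical to the sketch AND to REF1's probe, builder-verified); **L₁ `HeegnerExponentAtShaFourMinimalDoorNonEggAtTwo` in the R193a FORM under
the same name** (REF1 §193 MANDATORY re-type: AN-28c's binder `(W.quadraticTwist (NumberField.discr K : ℚ)).entireLFunction 1 ≠ 0 →` restored after `DoorAdmissible`;
body byte-identical to REF1's `HeegnerExponentAtShaFourMinimalDoorNonEggAtTwoNV`, only the def name line differs — so the filed L₁ is EXACTLY AN-28c `DoorIndexLawFullCAtTwo`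
on the locus `(s_W, s_d, t, s) = (0, 2, 0, 0)`, witnessed by `heegnerExponentAtShaFour_of_doorIndexLawFullCAtTwo` = REF1's `nv_of_doorIndexLawFullCAtTwo`); -es's
`padicValNat_two_four` and `lawful_identity_at_shaFourDoor` VERBATIM (R193d: the tree's `…Theorems.MultTowerCert.padicValNat_two_four` states `padicValNat 2 (2 * 2) = 2`,
a different statement in a module outside this cone — not imported); the glue `residueNonEgg_of_shaFourDoor : L₁ → SUPPLY₄ → R_N` with -es's signature and REF1's
`residueNonEgg_of_shaFourDoor_nv` proof body (one more argument `hL1`, supplied by SUPPLY₄'s non-vanishing conjunct).  Docstrings verbatim + one REF1-AUDIT §193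
and one REF2-PLACEMENT v50 §2 rider each; -es's module docstring reproduced below verbatim; typer key normalisation in docstring text: `McCallum1991` → `McCallumLMS1991`
(the tree's key for the same LMS 153 article).  Imports = the sketch's.  NOT FILED: REF1's BC7-E1/E2 lemmas about the OLD L₁ (`bc7_L1_heegner_point_infinite_order`,
`bc7_L1_forces_twist_nonvanishing` — they document why the sketch form was mis-typed and do not apply to the R193a form) and BC7-E4 (`bc7_U1_conclusion_vacuous…`,
needs the extra import `…OneDoorSubsliceNegDiscFloat`; recorded in U₁'s rider instead).
GRADES (REF1-AUDIT §193 D-es-61, REF1-AUDIT-v1.md tail, evidence `HOME/REF1-data/b193/` SHA16.txt): **L₁ MIS-TYPED as sketched — SURVIVES only with R193a** (its conclusion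
asserts an exact exponent EXISTS; a torsion `y_K` has none and `#Ш(Wd)[2^∞] = 4` is L-free, so the sketch form also asserted the RANK-0 2-CONVERSE for the θ = − twins =
`Theses.TwoAdicConverse` nodes 19556 / 19187, XL — kernel-checked `bc7_L1_forces_twist_nonvanishing` mod GZ + `exists_isNewformOf`); with R193a: existence of `m` = GZ +
Kolyvagin mod print (`exists_twoDivisibility_of_rankOne`), `m ≥ v₂(c) + 1` = U₀ (tree, theorem modulo print `doorIndexLawUpperCAtTwoBottom_of_print_ctFree`), OPEN part =
`m ≤ v₂(c) + 1` ⟺ «`y_K ∈ 2^{v₂(c)+2}E(K) + tors ⟹ Ш(Wd)[4] ≠ Ш(Wd)[2]`» — the advertised second bit, converse direction; **U₁ SURVIVES** (no hidden converse: conclusion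
vacuous at a torsion `y_K`; `¬ MeetsEgg` load-bearing, `ShaTwoTrivial` optional); **SUPPLY₄ SURVIVES** (supply conjecture; R193c: «θ = − hence L ≠ 0» in §27.4(c)/§27-add is the
2-converse, not BSD-free — count supply with `L(E^d, 1)` COMPUTED `≠ 0`: 9 707 / 10 357 θ = − doors have it; the two j328477 curves have none); glue CLEAN; binders audited
(load-bearing = `4 ∤ N`, `NontrivialAtTwo`-type slice data, odd Tamagawa; `Dt.c = 0` excluded by `deg_spec`; `Nat.card … = 4` asserts finiteness; on an `𝔽₂`-plane an
alternating form is `0` or non-degenerate, so θ = ± is a genuine dichotomy at rank-0 doors and L₁ ∪ U₁ cover every non-vanishing minimal door); D-es-60's reshaping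
(`stub_L1` + `stub_supply4`) is sound with the R193a form.  Census (BC5 witness, -es): ENGINE S j307611 re-read — 48 R_N minimal-door index rows: θ = − 33/33 with `m = 1`,
θ = + 15/15 with `m ≥ 2`; ENGINE S27 kit j327751 (9 492 rows), `ANALYSIS27-j327751.txt` bbf9780b92f8b38e.
REF2-PLACEMENT v50 §2 (dbb0660368a6f605, «MEMO-es §27 PLACED + D-es-62 ANSWERED»): L₁ / U₁ (second 2-divisibility of `y_K` ⟺ the Cassels–Tate bit) NOT IN PRINT at `2`
(Gross–Parson `ℓ` odd; W. Zhang `p ≥ 5`; [cite: KrizLi2019] = the `m = 0` layer; Jetchev / [cite: McCallumLMS1991] `p` odd) — -es's new-combination claim STANDS, BSD₂-shadow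
like Q31; D-es-62: YES, IN PRINT — [cite: Morgan2023KummerGeneric, Prop. 19]: on doors all of whose prime factors have `a_ℓ` odd, `θ(W^{(d)})` is AFFINE in the square class
of `d` (linear part = the central character of `M_W = K_{T,T′}`); doors with an `a_ℓ`-even factor: `Sel₂` moves (Kramer / KMR), no printed governing field (Smith 2022 I spin
regime) — state θ-laws / SUPPLY on the «all factors `a_ℓ` odd» sub-family; **SUPPLY₄ SPLITS**: (α) the ALGEBRAIC supply (infinitely many minimal PRIME doors with θ = −, hence
rank 0 and `Ш[2^∞] ≅ (ℤ/2)²` unconditionally, density ½) = COROLLARY OF PRINT ([cite: Morgan2023KummerGeneric, Lemma 16, Prop. 19, Cor. 34] + Chebotarev; `M_W ⊄ K_T·ℚ^{ab}`,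
v50 §1.8) — portable as SUPPLY₄^{alg}; (β) the clause `L(W^{(d_K)}, 1) ≠ 0` ON THOSE doors = OPEN IN PRINT (no 2-converse for non-CM; Frobenian non-vanishing [cite: OnoSkinner1998],
[cite: Ono2001, Thm. 1] lives on `D_E ×` EVEN products, not on the twins); REF2 recommends SUPPLY₄ := SUPPLY₄^{alg} ∧ NONVAN (the analytic residual shared with Q31).
Beyond-print theorem: no.  PARTITION none (R_N = R_N[∃ minimal θ = − door with L ≠ 0] ⊔ rest, §27.7).  BSD is not proved.  bears_on: stmt-BirchSwinnertonDyer-23715.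

## -es's module docstring of `Sketch27.lean` (verbatim; its L₁ bullet describes the INTENDED statement, which is the R193a form filed here)

# ES-27 (cell bsd-f1-sign2, seat -es g18): THE SECOND LAYER AT A MINIMAL ARCHIMEDEAN DOOR — a typed θ-split of the lead's residue R_N

Sketch only (planner seat; nothing here is proposed to the tree by this seat; the typer ports).  Crux `RankOneAtTwoBigImageOddLocal`
(stmt-BirchSwinnertonDyer-23715), LINE v8.17 `one_door_analytic`, registered stub `stub_residueNonEgg : S_pub4 → DoorIndexLawFullCAtTwoSomeDoorResidueNonEgg`.

Frame (Kramer 1981, Prop. 3 and Prop. 6; elementary Selmer comparison).  `W` of the slice with `Δ_W > 0`, `Ш(W)[2] = 0`, `E(ℚ) ⊂ E⁰(ℝ)`; `K = ℚ(√d_K)`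
with `d_K` door-admissible and the door MINIMAL (`t = s = 0`).  Then `Sel₂(W^{(d_K)}/ℚ) = ⟨κ(P_W), u⟩ ≅ 𝔽₂²` (the egg twist law, `#Sel₂ = 4`), so at a
door with `L(W^{(d_K)}, 1) ≠ 0` one has `Ш(W^{(d_K)})[2^∞] ≅ (ℤ/2^a)²` with `a ≥ 1`, and the AN-28c identity `2m + [Δ_W<0] = s_W + s_d + t + 2s + 2v₂(c)`
reads `m = a + v₂(c)`.  Its first layer `m ≥ v₂(c) + 1` is U₀'s contrapositive (tree, theorem modulo print:
`doorIndexLawUpperCAtTwoBottom_of_print_ctFree`).  The SECOND layer is the bit `a = 1` versus `a ≥ 2`, i.e. the Cassels–Tate bit of the twin on its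
`2`-Selmer plane: `θ = −` ⟺ `Ш(Wd)[2] ∩ 2Ш(Wd)[4] = 0` ⟺ `¬ ShaTwoInTwiceShaFour Wd` ⟺ `#Ш(Wd)[2^∞] = 4` — BSD-free decidable per row
(PARI `ellrank(E^d) = [0,0,2]`), as is the Heegner exponent `m` (ENGINE S AJ-matching).  The three statements below split R_N along `θ`:

* L₁ `HeegnerExponentAtShaFourMinimalDoorNonEggAtTwo` (converse half, second bit): `#Ш(Wd)[2^∞] = 4 ⟹ m = v₂(c) + 1`;
* U₁ `HeegnerExponentLowerBoundAtShaDeepMinimalDoorNonEggAtTwo` (Euler-system half, second rung): `ShaTwoInTwiceShaFour Wd ⟹ m ≥ v₂(c) + 2`;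
* SUPPLY₄ `ShaFourMinimalDoorSupplyNonEggAtTwo`: every R_N curve has a non-vanishing minimal admissible Heegner door datum with `#Ш(Wd)[2^∞] = 4`;

and the import-free glue `L₁ ∧ SUPPLY₄ ⟹ R_N` (`residueNonEgg_of_shaFourDoor`).  Census (BC5 witness): ENGINE S j307611 re-read (48 R_N minimal-door index rows:
`θ = −` 33/33 with `m = 1`; `θ = +` 15/15 with `m ≥ 2`) + ENGINE S27 (this seat's kit job, supply over 16 minimal doors per R_N curve).
-/

noncomputable section

open scoped Classical

namespace Summit.BirchSwinnertonDyer.Rank1Residual.F1Sign2.SecondLayerAtMinimalDoorAtTwo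

open Summit.BirchSwinnertonDyer.BirchSwinnertonDyer.Theorems.RankOneAtTwoOneDoor
open Literature.NumberTheory.EllipticCurves Literature.NumberTheory.EllipticCurves.ModularForms
  Summit.BirchSwinnertonDyer.Rank1Residual.F1Sign2

/-- **L₁ `HeegnerExponentAtShaFourMinimalDoorNonEggAtTwo` — THE SECOND BIT OF THE CONVERSE HALF AT A MINIMAL ARCHIMEDEAN DOOR (CONJECTURE, ES-27L).**
`W/ℚ` globally minimal, non-CM, `ρ_{W,2^n}` onto for all `n`, odd torsion order, odd Tamagawa product, analytic rank `1`, `Δ_W > 0`, `Ш(W)[2] = 0`,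
`E(ℚ) ⊂ E⁰(ℝ)` (`¬ MeetsEgg W`); `K` imaginary quadratic with `d_K` door-admissible and the door MINIMAL (`t = s = 0`), `(d_K, N_W) = 1`, the Heegner
hypothesis; `Wd` a globally minimal model of `W^{(d_K)}` with `#Ш(Wd)[2^∞] = 4` (⟺ rank `Wd(ℚ) = 0` and the Cassels–Tate form on `Sel₂(Wd) ≅ 𝔽₂²`
non-degenerate; PARI `ellrank = [0,0,2]`); `Dt` ANY parametrisation datum of level `N_W`, `H`, `ι`, `P ∈ E(K)` over the complex Heegner point.  THEN the
exact `2`-divisibility exponent of `P` modulo torsion is `v₂(c) + 1`.  It is AN-28c `DoorIndexLawFullCAtTwo` restricted to the locus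
`(s_W, s_d, t, s) = (0, 2, 0, 0)`; with U₀ (`m ≥ v₂(c)+1` here, theorem modulo print) only `m ≤ v₂(c) + 1` is open: «a Heegner point divisible by
`2^{v₂(c)+2}` modulo torsion forces `Ш(Wd)[4] ≠ Ш(Wd)[2]`», the `M = 4` layer of the converse (Kolyvagin-exactness) direction at `p = 2`.
Why it might fail: second Kolyvagin layer at `2` in the converse direction (no eigenspaces for complex conjugation on `E[4]`; the twist character
enters the Cassels–Tate pairing at level `4`); a single certified row `ellrank(E^d) = [0,0,2]` with `m ≥ 2` refutes it.  Census: ENGINE S j307611,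
`Δ > 0` minimal-door index rows with `ellrank(E) = [1,1,0]`, `ellrank(E^d) = [0,0,2]`: `m = 1` on 33/33 (BSD-free on both sides); ENGINE S27 (g18).
[cite: GrossLMS1991, Conj. 1.2, §3 and §10] [cite: Kramer1981, Prop. 3 and Prop. 6] [cite: Kolyvagin1990, Thm. A] [cite: GrossZagier1986, Thm. I.6.3 and V.§2]
**REF1-AUDIT §193 R193a (MANDATORY re-type, applied): the sketch's L₁ dropped AN-28c's binder `(W.quadraticTwist (NumberField.discr K : ℚ)).entireLFunction 1 ≠ 0 →`
and thereby also asserted the rank-0 2-converse for the θ = − twins (a torsion `y_K` has no exact exponent; kernel-checked in REF1's probe); the body below is REF1's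
`HeegnerExponentAtShaFourMinimalDoorNonEggAtTwoNV` VERBATIM under -es's name — AN-28c `DoorIndexLawFullCAtTwo` on the locus `(0, 2, 0, 0)` and nothing more
(`heegnerExponentAtShaFour_of_doorIndexLawFullCAtTwo` below).**  With it: existence of `m` = GZ + Kolyvagin mod print, `m ≥ v₂(c)+1` = U₀, open = `m ≤ v₂(c)+1`.
REF2-PLACEMENT v50 §2: NOT IN PRINT at `2` (Gross–Parson `ℓ` odd, W. Zhang `p ≥ 5`, [cite: KrizLi2019] the `m = 0` layer, [cite: McCallumLMS1991] `p` odd) — new-combination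
claim stands; BSD₂-shadow like Q31. -/
@[conjecture] def HeegnerExponentAtShaFourMinimalDoorNonEggAtTwo : Prop :=
  ∀ (W : WeierstrassCurve ℚ) [W.IsElliptic] [W.IsGloballyMinimal] [NeZero (W.conductorNorm ℤ)],
    ¬ W.HasCM → (∀ n : ℕ, W.HasSurjectiveModNGaloisRep ((2 ^ n : ℕ) : ℤ)) → Odd W.torsionOrder → Odd W.tamagawaProduct →
    W.analyticRank = 1 → 0 < W.Δ → ShaTwoTrivial W → ¬ MeetsEgg W →
    ∀ (K : Type) [Field K] [NumberField K], IsImaginaryQuadratic K →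
      DoorAdmissible W (NumberField.discr K) →
      (W.quadraticTwist (NumberField.discr K : ℚ)).entireLFunction 1 ≠ 0 →
      transpCount W (NumberField.discr K) + 2 * identCount W (NumberField.discr K) = 0 →
      Nat.Coprime (NumberField.discr K).natAbs (W.conductorNorm ℤ) → SatisfiesHeegnerHypothesis (W.conductorNorm ℤ) K →
      ∀ (Wd : WeierstrassCurve ℚ) [Wd.IsElliptic] [Wd.IsGloballyMinimal] (Cd : WeierstrassCurve.VariableChange ℚ),
        Cd • W.quadraticTwist (NumberField.discr K : ℚ) = Wd →
        Nat.card (AddCommGroup.primaryComponent Wd.sha 2) = 4 →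
      ∀ (Dt : ModularParametrizationData W (W.conductorNorm ℤ))
        (H : HeegnerDatum (W.conductorNorm ℤ) (NumberField.discr K)) (ι : K →+* ℂ)
        (P : (W.baseChange K).toAffine.Point),
        WeierstrassCurve.Affine.Point.map ι.toRatAlgHom P = heegnerPointComplex Dt H →
        HasTwoDivisibilityUpToTorsion W K P (padicValInt 2 Dt.c + 1)

/-- **U₁ `HeegnerExponentLowerBoundAtShaDeepMinimalDoorNonEggAtTwo` — THE SECOND RUNG OF THE EULER-SYSTEM HALF AT A MINIMAL ARCHIMEDEAN DOOR
(CONJECTURE, ES-27U).**  Same slice and door as L₁; `Wd` a globally minimal model of the twin with `Ш(Wd)[2] ⊆ 2Ш(Wd)[4]` (`ShaTwoInTwiceShaFour Wd`: the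
Cassels–Tate form on `Sel₂(Wd)` is identically zero; at a rank-`0` door this is `Ш(Wd)[2^∞] ≅ (ℤ/2^a)²` with `a ≥ 2`; PARI `ellrank = [0,2,0]`).  THEN
every exact `2`-divisibility exponent `m` of `P` modulo torsion satisfies `m ≥ v₂(c) + 2` (the Heegner point is divisible by `2^{v₂(c)+2}` modulo
torsion).  It is `DoorIndexLawUpperCAtTwo` at the locus `s_d ≥ 4` of a minimal archimedean door — the rung after the PROVED bottom rung U₀
(`doorIndexLawUpperCAtTwoBottom_of_print_ctFree`: `Sel₂(Wd) ≠ 0 ⟹ m ≥ v₂(c)+1`, from Gross's Prop. 3.7(2) mod `2`); this rung needs the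
mod-`4` localisation of the Kolyvagin classes `c(1), c(ℓ)` (McCallum) and is route GenusKolyvaginAtTwo's `U_T` at `M = 4` in one-door currency.
Why it might fail: the mod-`4` Kolyvagin relation at `2` needs `E[4]`-level Chebotarev primes and the sign `ε = −1` bookkeeping without
eigenspaces; a certified rank-`0` row with `ellrank(E^d) = [0,2,0]` and `m = v₂(c)+1` refutes it.  Census: ENGINE S j307611, `Δ > 0` minimal-door
index rows with `ellrank(E) = [1,1,0]`, `ellrank(E^d) = [0,2,0]`, `L(E^d,1) ≠ 0`: `m ≥ 2` on 15/15 (`m = 2`: 11, `3`: 3, `4`: 1; BSD shadow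
`#Ш_an(E^d) = 4^m` 15/15); ENGINE S27 (g18). [cite: GrossLMS1991, Prop. 3.7 and §10] [cite: McCallumLMS1991, Thm. 5.1 (shape only)] [cite: Kolyvagin1990, Thm. A]
REF1-AUDIT §193: **SURVIVES** (no hidden converse: the conclusion `∀ m, HasTwoDivisibilityUpToTorsion … m → v₂(c)+2 ≤ m` is VACUOUS at a torsion `y_K` — REF1's
`bc7_U1_conclusion_vacuous_of_isOfFinAddOrder` via the tree's `not_isOfFinAddOrder_of_hasTwoDivisibilityUpToTorsion`; `¬ MeetsEgg` load-bearing, `ShaTwoTrivial`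
optional; at rank-0 θ = + doors it is `DoorIndexLawUpperCAtTwo` at `s_d ≥ 4`).  REF2-PLACEMENT v50 §2: NOT IN PRINT at `2` (mod-4 Kolyvagin localisation: [cite: McCallumLMS1991]
shape only, `p` odd) — typer key normalisation of -es's `McCallum1991`. -/
@[conjecture] def HeegnerExponentLowerBoundAtShaDeepMinimalDoorNonEggAtTwo : Prop :=
  ∀ (W : WeierstrassCurve ℚ) [W.IsElliptic] [W.IsGloballyMinimal] [NeZero (W.conductorNorm ℤ)],
    ¬ W.HasCM → (∀ n : ℕ, W.HasSurjectiveModNGaloisRep ((2 ^ n : ℕ) : ℤ)) → Odd W.torsionOrder → Odd W.tamagawaProduct →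
    W.analyticRank = 1 → 0 < W.Δ → ShaTwoTrivial W → ¬ MeetsEgg W →
    ∀ (K : Type) [Field K] [NumberField K], IsImaginaryQuadratic K →
      DoorAdmissible W (NumberField.discr K) →
      transpCount W (NumberField.discr K) + 2 * identCount W (NumberField.discr K) = 0 →
      Nat.Coprime (NumberField.discr K).natAbs (W.conductorNorm ℤ) → SatisfiesHeegnerHypothesis (W.conductorNorm ℤ) K →
      ∀ (Wd : WeierstrassCurve ℚ) [Wd.IsElliptic] [Wd.IsGloballyMinimal] (Cd : WeierstrassCurve.VariableChange ℚ),
        Cd • W.quadraticTwist (NumberField.discr K : ℚ) = Wd →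
        ShaTwoInTwiceShaFour Wd →
      ∀ (Dt : ModularParametrizationData W (W.conductorNorm ℤ))
        (H : HeegnerDatum (W.conductorNorm ℤ) (NumberField.discr K)) (ι : K →+* ℂ)
        (P : (W.baseChange K).toAffine.Point),
        WeierstrassCurve.Affine.Point.map ι.toRatAlgHom P = heegnerPointComplex Dt H →
        ∀ m : ℕ, HasTwoDivisibilityUpToTorsion W K P m → padicValInt 2 Dt.c + 2 ≤ m

/-- **SUPPLY₄ `ShaFourMinimalDoorSupplyNonEggAtTwo` — EVERY R_N CURVE HAS A MINIMAL DOOR WHOSE TWIN HAS `#Ш[2^∞] = 4` (CONJECTURE, ES-27S).**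
`W` of the slice with `Δ_W > 0`, `Ш(W)[2] = 0`, `E(ℚ) ⊂ E⁰(ℝ)`.  THEN there is an imaginary quadratic `K` with `d_K` door-admissible, the door minimal
(`t = s = 0`), `(d_K, N_W) = 1`, the Heegner hypothesis, `L(W^{(d_K)}, 1) ≠ 0`, a parametrisation datum `Dt`, `H`, `ι`, a point `P ∈ E(K)` over the
complex Heegner point, and a globally minimal model `Wd` of the twist with `#Ш(Wd)[2^∞] = 4`.  The datum `(Dt, H, ι, P)` exists at every Heegner door
(modularity; Gross 1991 §3); the content is the DOOR: among the minimal admissible Heegner doors of `W` (all of which have `#Sel₂(Wd) = 4` by the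
egg twist law) one has analytic rank `0` AND Cassels–Tate bit `θ = −`.  A Chebotarev / governing-field statement in the style of Smith's
`2^∞`-Selmer distribution is the expected mechanism (is `θ(W^{(d)})` an affine function of the square class of `d` on the fixed plane
`⟨κ(P), u⟩`?).  Why it might fail: a curve all of whose rank-`0` minimal doors have `Ш(Wd)[4] ≠ Ш(Wd)[2]` (a governing obstruction forcing `θ = +`);
the non-vanishing conjunct is Hoffstein–Luo-type but must be met SIMULTANEOUSLY with `θ = −`.  Census: ENGINE S j307611 first minimal doors of the
55 identified R_N curves: `θ = −` at 39/55 first doors; -desc §27 CTL1-noegg 24/31 rank-`0` doors; ENGINE S27 (g18): position of the first `θ = −`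
door over 16 minimal doors per R_N curve. [cite: Kramer1981, Prop. 6] [cite: Smith2016GoverningFields, Thm. 1.1 (shape only)] [cite: HoffsteinLuo1997, Thm.]
[cite: GrossLMS1991, §3]
REF1-AUDIT §193: **SURVIVES** (supply conjecture; R193c: «θ = − hence `L ≠ 0`» is the 2-converse, not BSD-free — count supply with `L(E^d, 1)` COMPUTED `≠ 0`:
9 707 / 10 357 θ = − doors have it; quantifier shape ∀W ∃K ∃(Dt, H, ι, P, Wd) ✓).  REF2-PLACEMENT v50 §2: SPLITS — (α) algebraic supply (infinitely many minimal PRIME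
doors with θ = −, density ½; rank 0 and `Ш[2^∞] ≅ (ℤ/2)²` unconditionally) = COROLLARY OF PRINT ([cite: Morgan2023KummerGeneric, Lemma 16, Prop. 19, Cor. 34] + Chebotarev;
θ is AFFINE in the square class of `d` on the «all prime factors `a_ℓ` odd» doors, D-es-62); (β) `L(W^{(d_K)}, 1) ≠ 0` on THOSE doors = OPEN IN PRINT (Frobenian
non-vanishing [cite: Ono2001, Thm. 1] lives on other twist families) — REF2 recommends reading SUPPLY₄ as SUPPLY₄^{alg} ∧ NONVAN. -/
@[conjecture] def ShaFourMinimalDoorSupplyNonEggAtTwo : Prop :=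
  ∀ (W : WeierstrassCurve ℚ) [W.IsElliptic] [W.IsGloballyMinimal] [NeZero (W.conductorNorm ℤ)],
    ¬ W.HasCM → (∀ n : ℕ, W.HasSurjectiveModNGaloisRep ((2 ^ n : ℕ) : ℤ)) → Odd W.torsionOrder → Odd W.tamagawaProduct →
    W.analyticRank = 1 → 0 < W.Δ → ShaTwoTrivial W → ¬ MeetsEgg W →
    ∃ (K : Type) (_ : Field K) (_ : NumberField K), IsImaginaryQuadratic K ∧ DoorAdmissible W (NumberField.discr K) ∧
      transpCount W (NumberField.discr K) + 2 * identCount W (NumberField.discr K) = 0 ∧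
      Nat.Coprime (NumberField.discr K).natAbs (W.conductorNorm ℤ) ∧ SatisfiesHeegnerHypothesis (W.conductorNorm ℤ) K ∧
      (W.quadraticTwist (NumberField.discr K : ℚ)).entireLFunction 1 ≠ 0 ∧
      ∃ (Dt : ModularParametrizationData W (W.conductorNorm ℤ)) (H : HeegnerDatum (W.conductorNorm ℤ) (NumberField.discr K))
        (ι : K →+* ℂ) (P : (W.baseChange K).toAffine.Point) (Wd : WeierstrassCurve ℚ) (_ : Wd.IsElliptic) (_ : Wd.IsGloballyMinimal)
        (Cd : WeierstrassCurve.VariableChange ℚ),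
        WeierstrassCurve.Affine.Point.map ι.toRatAlgHom P = heegnerPointComplex Dt H ∧
          Cd • W.quadraticTwist (NumberField.discr K : ℚ) = Wd ∧ Nat.card (AddCommGroup.primaryComponent Wd.sha 2) = 4

/-! ### Import-free glue: `L₁ ∧ SUPPLY₄ ⟹ R_N` -/

/-- `ord₂ 4 = 2`. -/
theorem padicValNat_two_four : padicValNat 2 4 = 2 := by
  have h : (4 : ℕ) = 2 ^ 2 := by norm_num
  rw [h, padicValNat.prime_pow]

/-- **The AN-28c identity at a `#Ш(Wd)[2^∞] = 4` minimal archimedean door of a `Ш(W)[2] = 0` curve holds with exponent `v₂(c) + 1`**: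
`2(v₂(c)+1) + [Δ_W<0] = s_W + ord₂ 4 + t + 2s + 2v₂(c)` with `s_W = 0` (`padicValNat_card_primaryComponent_sha_two_eq_zero_of_shaTwoTrivial`), `[Δ_W<0] = 0`
and `t + 2s = 0`.  Import-free arithmetic, isolated so that `omega` runs in a small context. [cite: GrossLMS1991, Conj. 1.2 and §3] -/
theorem lawful_identity_at_shaFourDoor (W Wd : WeierstrassCurve ℚ) [W.IsElliptic] [Wd.IsElliptic] (hSha : ShaTwoTrivial W) (hΔ : 0 < W.Δ)
    (h4 : Nat.card (AddCommGroup.primaryComponent Wd.sha 2) = 4) (t s : ℕ) (hmin : t + 2 * s = 0) (c : ℤ) :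
    2 * (padicValInt 2 c + 1) + (if W.Δ < 0 then 1 else 0) =
      padicValNat 2 (Nat.card (AddCommGroup.primaryComponent W.sha 2)) +
        padicValNat 2 (Nat.card (AddCommGroup.primaryComponent Wd.sha 2)) + t + 2 * s + 2 * padicValInt 2 c := by
  have hsW : padicValNat 2 (Nat.card (AddCommGroup.primaryComponent W.sha 2)) = 0 :=
    padicValNat_card_primaryComponent_sha_two_eq_zero_of_shaTwoTrivial W hSha
  have hsd : padicValNat 2 (Nat.card (AddCommGroup.primaryComponent Wd.sha 2)) = 2 := by
    rw [h4]; exact padicValNat_two_four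
  have hneg : (if W.Δ < 0 then 1 else 0 : ℕ) = 0 := if_neg (not_lt.mpr (le_of_lt hΔ))
  omega

/-- **ES-27 GLUE: `L₁ ∧ SUPPLY₄ ⟹ R_N`** (`DoorIndexLawFullCAtTwoSomeDoorResidueNonEgg`).  At the supplied door the AN-28c identity holds with L₁'s
exponent (`lawful_identity_at_shaFourDoor`).  Import-free bookkeeping; no printed fact is used: modulo L₁ and SUPPLY₄ the non-egg residue of LINE v8.17
closes, i.e. `stub_residueNonEgg ⟸ stub_L₁ ∘ stub_SUPPLY₄`. [cite: GrossLMS1991, Conj. 1.2 and §3]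
(R193a port: -es's signature; proof body = REF1 §193 `residueNonEgg_of_shaFourDoor_nv` VERBATIM — `hL` now receives the non-vanishing witness `hL1` that SUPPLY₄ already supplies;
glue CLEAN per REF1.) -/
theorem residueNonEgg_of_shaFourDoor (hL : HeegnerExponentAtShaFourMinimalDoorNonEggAtTwo) (hS : ShaFourMinimalDoorSupplyNonEggAtTwo) :
    DoorIndexLawFullCAtTwoSomeDoorResidueNonEgg := by
  intro W _ _ _ hCM hsurj hT hc hr hΔ hSha hegg
  obtain ⟨K, iF, iN, hK, hadm, hmin, hcop, hHN, hL1, Dt, H, ι, P, Wd, iE, iG, Cd, hP, hWd, h4⟩ :=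
    hS W hCM hsurj hT hc hr hΔ hSha hegg
  have hm : HasTwoDivisibilityUpToTorsion W K P (padicValInt 2 Dt.c + 1) :=
    hL W hCM hsurj hT hc hr hΔ hSha hegg K hK hadm hL1 hmin hcop hHN Wd Cd hWd h4 Dt H ι P hP
  refine ⟨K, iF, iN, hK, hadm, hL1, Dt, H, ι, P, Wd, iE, iG, Cd, hP, hWd, padicValInt 2 Dt.c + 1, hm, ?_⟩
  exact lawful_identity_at_shaFourDoor W Wd hSha hΔ h4 _ _ hmin Dt.c

/-- **AN-28c ⟹ L₁** (REF1 §193 R193a certificate `nv_of_doorIndexLawFullCAtTwo`, proof VERBATIM, renamed for the filed L₁): import-free arithmetic — at the locus the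
AN-28c identity pins `m = v₂(c) + 1` (`lawful_identity_at_shaFourDoor` + `omega`), so the filed L₁ is EXACTLY `DoorIndexLawFullCAtTwo` on the locus `(s_W, s_d, t, s) = (0, 2, 0, 0)`. -/
theorem heegnerExponentAtShaFour_of_doorIndexLawFullCAtTwo (h : DoorIndexLawFullCAtTwo) : HeegnerExponentAtShaFourMinimalDoorNonEggAtTwo := by
  intro W _ _ _ hCM hsurj hT hc hr hΔ hSha _ K _ _ hK hadm hLt hmin _ _ Wd _ _ Cd hWd h4 Dt H ι P hP
  obtain ⟨m, hm, hlaw⟩ := h W hCM hsurj hT hc hr K hK hadm hLt Dt H ι P hP Wd Cd hWd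
  have hid := lawful_identity_at_shaFourDoor W Wd hSha hΔ h4 _ _ hmin Dt.c
  have hmeq : m = padicValInt 2 Dt.c + 1 := by omega
  exact hmeq ▸ hm

end Summit.BirchSwinnertonDyer.Rank1Residual.F1Sign2.SecondLayerAtMinimalDoorAtTwo

end
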